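import Summits.AtomisticToContinuum.Crystallization.Theorems.PalmUnimodularRigidityLayeredLawsSelectHcpCertificateDefs
import Summits.AtomisticToContinuum.Crystallization.Theorems.PalmUnimodularRigidityLayeredLawsSelectHcpRootedChartUnique
import Summits.AtomisticToContinuum.Crystallization.Theorems.PalmUnimodularRigidityLayeredLawsSelectHcpStarGreedyStep
import Summits.AtomisticToContinuum.Crystallization.Theorems.PalmUnimodularRigidityMinimiserShellsEnergyFloorC
import Mathlib.MeasureTheory.Integral.Bochner.SumMeasure
import Mathlib.MeasureTheory.Measure.Count

/-!
# Crux `LayeredLawsSelectHcp` (stmt-AtomisticToContinuum-9226), line `mtp-prestress-split-ergodic-frame`: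
# the root energy against `count|S` is the label sum over a rooted chart

Registered sub-goal `tube_rootEnergy_hasSum_chart` (L1 of the far-field plan, `Cruxes/LayeredLawsSelectHcp/LeadC3FarField.md`
§4, §6): for an every-point-good carrier `S ⊆ ℝ³` and a rooted labelled chart `X : ℤ³ → S` (`X 0 = 0`, onto `S`, ideal unit
struts ↔ bonds) the root energy integral `∫ V_LJ(‖y‖) d(count|S)` is the `HasSum` of the label family `u ↦ V_LJ(‖X u‖)`, so that
it can be split into near / mid / far LABEL shells.  Mechanism:

* good shells give the hard core: `S` is `891/1000`-separated (`hardCore` of the sibling crux `ShellsToBarlowChart`, through the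
  `Iff.rfl` bridge `GoodShell S x ↔ GoodShellAt (9/10) 1 S x`), hence countable (`countable_of_separated`);
* `y ↦ V_LJ(‖y‖)` is integrable against `count|S` (the rooted hard-core machinery of the energy-floor line:
  `lintegral_pos_ne_top_of_hc`, `lintegral_neg_le_of_hc`, `integrable_of_lintegral_ofReal_ne_top`) and absolutely summable over
  `S` (`UniformlyDiscrete.summable_lennardJones`: `r⁻⁶` tail and shell counting);
* on a countable set the Bochner integral against `count|S` is the `tsum` over `S` (`MeasureTheory.setIntegral_countable`, all
  singletons have count-mass one);
* the chart is injective (`RootedChartUnique.chart_injective`) and onto, so `S = range X` and the `HasSum` over `S` re-indexes to the labels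
  (`Function.Injective.hasSum_range_iff`).

All `[folklore]`.
-/

noncomputable section

namespace Summit.AtomisticToContinuum.Crystallization.Theorems.PalmUnimodularRigidity.LayeredLawsSelectHcp

open MeasureTheory Set
open Literature.MathematicalPhysics.StatisticalMechanics Literature.Geometry.DiscreteGeometry
open Literature.Probability.Process (IsRootedHardCore)
open Summit.AtomisticToContinuum.Crystallization.Theorems.LayeredLawsSelectHcp.Negative.DiracLaws (GoodShell)
open Summit.AtomisticToContinuum.Crystallization.Theorems.PalmUnimodularRigidityShellsToBarlowChart (hardCore)
open Summit.AtomisticToContinuum.Crystallization.Theorems.MinimiserShells.Negative.Rootedness (countable_of_separated)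
open Summit.AtomisticToContinuum.Crystallization.Theorems.PalmUnimodularRigidityMinimiserShells.EnergyFloor
  (measurable_lennardJones integrable_of_lintegral_ofReal_ne_top lintegral_pos_ne_top_of_hc lintegral_neg_le_of_hc)

/-- **Hard core of an every-point-good set**: distinct points of `S` are `≥ 891/1000` apart (the sibling crux's `hardCore`
through the `Iff.rfl` bridge of the two good-shell predicates). [folklore] -/
theorem goodShell_separated {S : Set (EuclideanSpace ℝ (Fin 3))} (hS : ∀ x ∈ S, GoodShell S x) :
    ∀ x ∈ S, ∀ y ∈ S, x ≠ y → 891 / 1000 ≤ dist x y :=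
  fun _ hx _ hy hne => hardCore (fun z hz => (goodShell_iff_goodShellAt S z).1 (hS z hz)) hx hy hne

/-- **The root Lennard-Jones field is integrable against `count|S`** for an every-point-good `S ∋ 0` (`count|S` is a rooted
`891/1000`-hard-core configuration; positive and negative parts have finite `lintegral`s by shell counting). [folklore] -/
theorem integrable_lennardJones_norm_count_restrict {S : Set (EuclideanSpace ℝ (Fin 3))}
    (hS : ∀ x ∈ S, GoodShell S x) (h0 : (0 : EuclideanSpace ℝ (Fin 3)) ∈ S) :
    Integrable (fun y : EuclideanSpace ℝ (Fin 3) => lennardJones ‖y‖)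
      ((Measure.count : Measure (EuclideanSpace ℝ (Fin 3))).restrict S) := by
  have hδ : (0 : ℝ) < 891 / 1000 := by norm_num
  have hhc : IsRootedHardCore (891 / 1000) ((Measure.count : Measure (EuclideanSpace ℝ (Fin 3))).restrict S) :=
    ⟨S, h0, goodShell_separated hS, rfl⟩
  exact integrable_of_lintegral_ofReal_ne_top (measurable_lennardJones.comp measurable_norm)
    (lintegral_pos_ne_top_of_hc hδ hhc) (((lintegral_neg_le_of_hc hδ hhc).trans_lt ENNReal.ofReal_lt_top).ne)

/-- **Bochner integrals against `count|S` on a countable `S` are `tsum`s over `S`** (every singleton has count-mass one).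
[folklore] -/
theorem integral_count_restrict_eq_tsum {S : Set (EuclideanSpace ℝ (Fin 3))} (hSc : S.Countable)
    {f : EuclideanSpace ℝ (Fin 3) → ℝ}
    (hf : Integrable f ((Measure.count : Measure (EuclideanSpace ℝ (Fin 3))).restrict S)) :
    ∫ y, f y ∂((Measure.count : Measure (EuclideanSpace ℝ (Fin 3))).restrict S) = ∑' y : S, f y := by
  rw [setIntegral_countable f hSc hf]
  simp only [count_real_singleton, one_smul]

/-- **Registered sub-goal `tube_rootEnergy_hasSum_chart` (L1).**  For an every-point-good carrier `S` and a rooted labelled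
chart `X` of `S`, the root energy integral `∫ V_LJ(‖y‖) d(count|S)` is the sum of the label family `u ↦ V_LJ(‖X u‖)`:
hard core ⇒ countable carrier and absolutely summable field, integral = `tsum` over `S`, re-indexed through the bijection
`X : ℤ³ → S`. [folklore] -/
theorem tube_rootEnergy_hasSum_chart : ∀ (S : Set (EuclideanSpace ℝ (Fin 3))) (X : ℤ × ℤ × ℤ → EuclideanSpace ℝ (Fin 3)), (∀ x ∈ S, GoodShell S x) → IsRootedChart S X → HasSum (fun u : ℤ × ℤ × ℤ => lennardJones ‖X u‖) (∫ y, lennardJones ‖y‖ ∂((Measure.count : Measure (EuclideanSpace ℝ (Fin 3))).restrict S)) := by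
  intro S X hS hX
  obtain ⟨hX0, hXS, hsurj, hbond⟩ := hX
  have hsep := goodShell_separated hS
  have h0S : (0 : EuclideanSpace ℝ (Fin 3)) ∈ S := hX0 ▸ hXS 0
  have hSc : S.Countable := countable_of_separated (by norm_num) hsep
  -- the integral against `count|S` is the `tsum` over `S` of an absolutely summable family
  rw [integral_count_restrict_eq_tsum hSc (integrable_lennardJones_norm_count_restrict hS h0S)]
  have hsum : Summable fun y : S => lennardJones ‖(y : EuclideanSpace ℝ (Fin 3))‖ := by
    have h := UniformlyDiscrete.summable_lennardJones ⟨891 / 1000, by norm_num, hsep⟩ 0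
    simpa only [dist_zero_left] using h
  -- re-index through the bijection `X : ℤ³ → S`
  have hrange : Set.range X = S :=
    Set.ext fun y => ⟨fun ⟨u, hu⟩ => hu ▸ hXS u, fun hy => hsurj y hy⟩
  subst hrange
  exact ((RootedChartUnique.chart_injective hbond).hasSum_range_iff (f := fun y : EuclideanSpace ℝ (Fin 3) => lennardJones ‖y‖)).1
    hsum.hasSum

end Summit.AtomisticToContinuum.Crystallization.Theorems.PalmUnimodularRigidity.LayeredLawsSelectHcp

end
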